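import Summits.CriticalPhenomena.CardyFormulaZ2.Theses.CardyRotToConf
import Literature.Probability.RandomPlanarGeometry.SLEImageDriverIncrement
import HarnessLib

/-!
# Stub `stub_sleImageDriverIncrement` of line `germ-label-transport` (crux `stmt-CriticalPhenomena-0698`)

Brick (c2) of `stub_isLocal` (LSW locality of SLE₆, restriction form): the conditional one-step estimates
of the image driving value `W̃_t = W_t + L_A − L_{B_t}` of Lawler–Schramm–Werner (2003) §5 at `κ = 6`.
For a nonempty `*`-hull `A`, a controlled class (`δ₀ ≤ Φ'_{B_u}(0)`, `B(0, 8ρ₀)` off `B_u = A_u − W_u`,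
`ρ₀ ≤ 1`), a horizon `T` and the path functional `imageDrvFnK 6 A t = W̃_t − L_A` (assumed measurable),
there is `C = C(A, δ₀, ρ₀, T)` such that for `u ≤ T`, `192 h ≤ (δ₀ρ₀/4000)²` and every `𝓕_u`-measurable
weight `g : Ω → [0, 1]` supported in the class, `|E[g (W̃_{u+h} − W̃_u)]| ≤ C h√h` and
`|E[g ((W̃_{u+h} − W̃_u)² − 6 Φ'_{B_u}(0)² h)]| ≤ C h√h` — the one-step skeleton of "`W̃` is a continuous
local martingale with bracket `6 ∫ h_s'(W_s)² ds`" (locality of SLE₆). The registered stub signature, an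
instance of the Literature theorem `exists_abs_integral_mul_imageDrv_sub_le`
(`SLEImageDriverIncrement.lean`: freezing of the Brownian past, identification of the frozen step with
`Loewner.imageDriverStep` on the good event, envelope `|ΔW̃| ≤ 3482√6 sup|β| + 15080√(u+h) + 1160 R`
off it, and the deterministic-hull bounds `abs_integral_imageDriver_le_six`,
`abs_integral_imageDriver_sq_sub_le`). The constant depends on the horizon because `L_{B_u}` is unbounded
over the controlled class (see the module docstring of `SLEImageDriverIncrement.lean`).

References: G. F. Lawler, O. Schramm, W. Werner, *Conformal restriction: the chordal case*, J. Amer. Math.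
Soc. 16 (2003), §5; G. F. Lawler, *Conformally Invariant Processes in the Plane* (2005), §4.6.1, §6.3.
-/

noncomputable section

open MeasureTheory
open Literature.Probability Literature.Probability.RandomPlanarGeometry

namespace Summit.CriticalPhenomena.CardyFormulaZ2.Theorems.CardyRotToConfR2SymmetryUpgrade

/-- **(c2).** Conditional one-step estimates of `W̃ − L_A = imageDrvFnK 6 A` at `κ = 6` on a controlled
class, with a constant uniform in `u ≤ T`: `|E[g ΔW̃]| ≤ C h√h`, `|E[g ((ΔW̃)² − 6 Φ'_{B_u}(0)² h)]| ≤ C h√h`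
(`exists_abs_integral_mul_imageDrv_sub_le`). [cite: LawlerSchrammWerner2003Restriction, §5 (remark after (5.1))] -/
theorem stub_sleImageDriverIncrement : ∀ [MeasurableSpace C(NNReal, ℝ)] [BorelSpace C(NNReal, ℝ)] {A : Set ℂ}, IsStarHull A → A.Nonempty → ∀ {δ₀ ρ₀ : ℝ}, 0 < ρ₀ → ρ₀ ≤ 1 → 0 < δ₀ → δ₀ ≤ 1 → (∀ t, Measurable (imageDrvFnK 6 A t)) → ∀ (T : NNReal), ∃ C : ℝ, 0 ≤ C ∧ ∀ (u h : NNReal), u ≤ T → 0 < h → 192 * (h : ℝ) ≤ (δ₀ * ρ₀ / 4000) ^ 2 → ∀ {g : (NNReal → ℝ) → ℝ}, Measurable[brownianFiltration u] g → (∀ ω, g ω ∈ Set.Icc (0 : ℝ) 1) → (∀ ω, g ω ≠ 0 → Disjoint (Loewner.closedHull (drvK 6 (brownianCPath ω)) u) A ∧ Disjoint (Metric.ball (0 : ℂ) (8 * ρ₀)) (Loewner.slidHull (drvK 6 (brownianCPath ω)) A u) ∧ δ₀ ≤ starDeriv (Loewner.slidHull (drvK 6 (brownianCPath ω)) A u))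 → |∫ ω, g ω * (imageDrvFnK 6 A (u + h) (brownianCPath ω) - imageDrvFnK 6 A u (brownianCPath ω)) ∂Process.preWienerMeasure| ≤ C * h * Real.sqrt h ∧ |∫ ω, g ω * ((imageDrvFnK 6 A (u + h) (brownianCPath ω) - imageDrvFnK 6 A u (brownianCPath ω)) ^ 2 - 6 * starDeriv (Loewner.slidHull (drvK 6 (brownianCPath ω)) A u) ^ 2 * h) ∂Process.preWienerMeasure| ≤ C * h * Real.sqrt h := by
  intro _ _ A hA hne δ₀ ρ₀ hρ₀ hρ1 hδ0 hδ1 hmeas T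
  exact exists_abs_integral_mul_imageDrv_sub_le hA hne hρ₀ hρ1 hδ0 hδ1 hmeas T

end Summit.CriticalPhenomena.CardyFormulaZ2.Theorems.CardyRotToConfR2SymmetryUpgrade

end
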